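import Literature.AlgebraicGeometry.Motives.HodgeStructureCentralizerDiagonalAction
import HarnessLib

/-!
# «PROPOSITION 1.5 … IS AN IMMEDIATE CONSEQUENCE OF PROPOSITION 1.1»: every isomorphism of algebras with involution
# `(C(H₁), †₁) ≃ₐ (C(H₂), †₂)` between Milne centralizers induces an isomorphism `S(H₁)(ℚ) ≃* S(H₂)(ℚ)` of the Lefschetz groups
# `S = {γ ∈ C | γ†γ = 1}` lying over it; hence THE DIAGONAL ACTION `S(H₀, ψ₀)(ℚ) ≃* S(⊕ᵢ Tᵢ ≅ H₀^{⊕ι}, ψ')(ℚ)` WITH ITS FORMULA and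
# THE CANONICAL BLOCK `S(S, ψ|_S)(ℚ) ≃* S(U, ψ|_U)(ℚ)` BY RESTRICTION (Milne 1999 §1 p. 644 L16–L28, Prop. 1.5)

[topic AlgebraicGeometry/Motives]

Layer `Literature/AlgebraicGeometry/Motives`, lane `lit-hodgefound` (Track 2 foundations library; prover seat
`lit-hodgefound-p02`, generation 53, self-proposed row g53-#4). THEOREMS ONLY: no definition, no named fact (net debt `0`),
no instance, no notation.  Sequel, BY NAME (nothing restated), of g53-#3 `Motives/HodgeStructureCentralizerDiagonalAction` (the
isomorphisms of algebras with involution `C(H₀) ≃ₐ C(H')` — the diagonal action — and `C(S) ≃ₐ C(U)` — restriction — WITH their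
formulas) and of p34's `Polarization.mem_lefschetzGroup_iff_adjoint_mul_self_eq_one` («`S(A)(k) = {γ ∈ C(A) | γ†γ = 1}`» literally,
`Motives/HodgeStructureLefschetzGroupPoints`).  g52-#6 (`Motives/HodgeStructureLefschetzGroupIsotypicBlock`) has the same two group
isomorphisms as bare `Nonempty`; here they come with their formulas, deduced from the `C`-isomorphisms exactly as Milne deduces
Prop. 1.5 from Prop. 1.1.

## The source, verbatim

J. S. Milne, *Lefschetz classes on abelian varieties*, Duke Math. J. 96 (1999) 639–675 [Milne1999LefschetzClasses] (held
`paper:doi-10-1215-s0012-7094-99-09620-5`), p. 643 L12–L13: "the diagonal action of `C(A)` on `rV(A)` identifies `C(A)` with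
`C(A^r)` (as `k`-algebras with involution)"; p. 644 L16–L28: "we define `S(A)` to be the algebraic subgroup of `GL(V(A))` such that,
for all commutative `k`-algebras `R`, `S(A)(R) = {γ ∈ C(A) ⊗_k R | γ†γ = 1}`. … Clearly `S(A)` depends only on the isogeny class of `A`
(up to a unique isomorphism). … **Proposition 1.5.** … Any such isogeny induces an isomorphism `S(A₁) × ⋯ × S(A_s) → S(A)`, which
is independent of the choice of the isogeny. *Proof.* This is an immediate consequence of Proposition 1.1."  Also H. Lange
[Lange2023AbelianVarietiesComplex] §7.2.4 Exercise (4), D. Huybrechts [Huybrechts2016K3] §3.3.5 eq. (3.3).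

## Dictionary and what is proved (namespace `Literature.AlgebraicGeometry.Motives.HodgeStructure`)

`C(H) = Subalgebra.centralizer ℚ (H.endAlg : Set (Module.End ℚ V))`, `S(H, Q)(ℚ) = Q.lefschetzGroup ≤ GL(V)`, `†_Q = Q.adjoint`.

* §1 **`Polarization.exists_lefschetzGroup_mulEquiv_coe_eq_of_algEquiv_adjoint`** («an immediate consequence of Proposition 1.1»:
  an isomorphism `e : C(H₁) ≃ₐ[ℚ] C(H₂)` with `e (γ^{†₁}) = (e γ)^{†₂}` induces `E : S(H₁, Q₁)(ℚ) ≃* S(H₂, Q₂)(ℚ)` with `↑(E g) = e ↑g` —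
  `S = {γ ∈ C | γ†γ = 1}` is functorial in `(C, †)`; `e γ` is an automorphism because `(e γ)† (e γ) = e(γ†γ) = 1` on the
  finite-dimensional `V`).
* §2 (internal `V' = ⊕ᵢ Tᵢ`, Hodge isomorphisms `rᵢ : H₀ ⥲ Tᵢ`) `Polarization.lefschetzGroup_map_eq_of_forall_apply_hom_eq` (two maps
  `S(H₀)(ℚ) → S(H')(ℚ)` acting diagonally coincide), **`Polarization.exists_lefschetzGroup_mulEquiv_apply_hom_eq`** (THE DIAGONAL ACTION
  `S(H₀, ψ₀)(ℚ) ≃* S(H', ψ')(ℚ)`, `(E g₀)(rᵢ x) = rᵢ (g₀ x)`, for ANY polarizations — «`S(Aᵢ^{rᵢ}) ≅ S(Aᵢ)`»).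
* §3 (polarized `H`, `S` minimal non-zero `E_φ`-stable, `U ⊆ S` irreducible) `Polarization.lefschetzGroup_restrict_map_eq_of_forall_coe_apply_eq`
  (two maps over the restriction coincide), **`Polarization.exists_lefschetzGroup_restrict_mulEquiv_coe_apply_eq_of_minimal_stable`**
  (RESTRICTION TO `U` is an isomorphism `S(S, ψ|_S)(ℚ) ≃* S(U, ψ|_U)(ℚ)`, `(E g) u = g u`),
  `Polarization.existsUnique_mem_lefschetzGroup_restrict_forall_coe_apply_eq_of_minimal_stable` (every `δ ∈ S(U)(ℚ)` is the restriction
  of a unique `g ∈ S(S)(ℚ)`).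
-/

noncomputable section

namespace Literature.AlgebraicGeometry.Motives

namespace HodgeStructure

universe u

variable {n : ℤ}

/-! ## §1 `S = {γ ∈ C | γ†γ = 1}` is functorial in the algebra with involution `(C, †)` -/

section Functorial

variable {V W : Type u} [AddCommGroup V] [Module ℚ V] [Module.Finite ℚ V] [AddCommGroup W] [Module ℚ W] [Module.Finite ℚ W]
  {H₁ : HodgeStructure V n} {H₂ : HodgeStructure W n}

/-- **«Proposition 1.5 … is an immediate consequence of Proposition 1.1»**: an isomorphism of `ℚ`-algebras
`e : C(H₁) ≃ₐ[ℚ] C(H₂)` between Milne centralizers carrying the adjoint `†₁` of a polarization `Q₁` to the adjoint `†₂` of a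
polarization `Q₂` induces an isomorphism of groups `E : S(H₁, Q₁)(ℚ) ≃* S(H₂, Q₂)(ℚ)` LYING OVER `e`: `↑(E g) = e ↑g` in `End(W)`
(`S(A)(k) = {γ ∈ C(A) | γ†γ = 1}`: for `g ∈ S(H₁)(ℚ)`, `(e g)†(e g) = e(g†g) = e 1 = 1`, so `e g` is injective, hence an automorphism of
the finite-dimensional `W`, and lies in `S(H₂)(ℚ)`; symmetrically for `e⁻¹`).
[cite: Milne1999LefschetzClasses, §1 p. 644 L16–L18 and Prop. 1.5 with its proof] [cite: Lange2023AbelianVarietiesComplex, §7.2.4 Exercise (4)] -/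
theorem Polarization.exists_lefschetzGroup_mulEquiv_coe_eq_of_algEquiv_adjoint (Q₁ : Polarization H₁) (Q₂ : Polarization H₂)
    (e : Subalgebra.centralizer ℚ (H₁.endAlg : Set (Module.End ℚ V)) ≃ₐ[ℚ]
      Subalgebra.centralizer ℚ (H₂.endAlg : Set (Module.End ℚ W)))
    (he : ∀ γ : Subalgebra.centralizer ℚ (H₁.endAlg : Set (Module.End ℚ V)),
      ((e ⟨Q₁.adjoint γ, Q₁.adjoint_mem_centralizer_endAlg γ.2⟩ :
          Subalgebra.centralizer ℚ (H₂.endAlg : Set (Module.End ℚ W))) : Module.End ℚ W) =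
        Q₂.adjoint ((e γ : Subalgebra.centralizer ℚ (H₂.endAlg : Set (Module.End ℚ W))) : Module.End ℚ W)) :
    ∃ E : Q₁.lefschetzGroup ≃* Q₂.lefschetzGroup, ∀ g : Q₁.lefschetzGroup,
      (((E g : Q₂.lefschetzGroup) : W ≃ₗ[ℚ] W) : Module.End ℚ W) =
        (e ⟨((g : V ≃ₗ[ℚ] V) : Module.End ℚ V), ((Q₁.mem_lefschetzGroup_iff_adjoint_mul_self_eq_one _).1 g.2).1⟩ :
          Subalgebra.centralizer ℚ (H₂.endAlg : Set (Module.End ℚ W))) := by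
  -- `g ↦ ⟨↑g, _⟩ : S(H₁)(ℚ) → C(H₁)` is multiplicative and `γ_g† γ_g = 1` in `C(H₁)`
  have hC : ∀ g : Q₁.lefschetzGroup, ((g : V ≃ₗ[ℚ] V) : Module.End ℚ V) ∈
      Subalgebra.centralizer ℚ (H₁.endAlg : Set (Module.End ℚ V)) ∧
        Q₁.adjoint ((g : V ≃ₗ[ℚ] V) : Module.End ℚ V) * ((g : V ≃ₗ[ℚ] V) : Module.End ℚ V) = 1 := fun g =>
    (Q₁.mem_lefschetzGroup_iff_adjoint_mul_self_eq_one _).1 g.2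
  let c : Q₁.lefschetzGroup → Subalgebra.centralizer ℚ (H₁.endAlg : Set (Module.End ℚ V)) := fun g => ⟨_, (hC g).1⟩
  have hc_one : c 1 = 1 := Subtype.ext rfl
  have hc_mul : ∀ g g' : Q₁.lefschetzGroup, c (g * g') = c g * c g' := fun g g' => Subtype.ext rfl
  have hc_adj : ∀ g : Q₁.lefschetzGroup,
      (⟨Q₁.adjoint (c g), Q₁.adjoint_mem_centralizer_endAlg (c g).2⟩ :
        Subalgebra.centralizer ℚ (H₁.endAlg : Set (Module.End ℚ V))) * c g = 1 := fun g =>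
    Subtype.ext (by rw [MulMemClass.coe_mul, OneMemClass.coe_one]; exact (hC g).2)
  -- `(e γ_g)† (e γ_g) = 1`, so `e γ_g` is an automorphism lying in `S(H₂)(ℚ)`
  have hone : ∀ g : Q₁.lefschetzGroup,
      Q₂.adjoint ((e (c g) : Subalgebra.centralizer ℚ (H₂.endAlg : Set (Module.End ℚ W))) : Module.End ℚ W) *
        ((e (c g) : Subalgebra.centralizer ℚ (H₂.endAlg : Set (Module.End ℚ W))) : Module.End ℚ W) = 1 := fun g => by
    rw [← he, ← MulMemClass.coe_mul, ← map_mul, hc_adj, map_one, OneMemClass.coe_one]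
  have hinj : ∀ g : Q₁.lefschetzGroup,
      Function.Injective ((e (c g) : Subalgebra.centralizer ℚ (H₂.endAlg : Set (Module.End ℚ W))) : Module.End ℚ W) :=
    fun g v w hvw => by
    have h := congrArg (Q₂.adjoint ((e (c g) : Subalgebra.centralizer ℚ (H₂.endAlg : Set (Module.End ℚ W))) :
      Module.End ℚ W)) hvw
    rwa [← Module.End.mul_apply, ← Module.End.mul_apply, hone g, Module.End.one_apply, Module.End.one_apply] at h
  have hmem : ∀ g : Q₁.lefschetzGroup, LinearEquiv.ofInjectiveEndo _ (hinj g) ∈ Q₂.lefschetzGroup := fun g =>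
    (Q₂.mem_lefschetzGroup_iff_adjoint_mul_self_eq_one _).2 ⟨(e (c g)).2, hone g⟩
  -- the group homomorphism `E₀ : S(H₁)(ℚ) →* S(H₂)(ℚ)`, `↑(E₀ g) = e γ_g`
  let E₀ : Q₁.lefschetzGroup →* Q₂.lefschetzGroup :=
    { toFun := fun g => ⟨LinearEquiv.ofInjectiveEndo _ (hinj g), hmem g⟩
      map_one' := Subtype.ext (LinearEquiv.ext fun w => by
        change ((e (c 1) : Subalgebra.centralizer ℚ (H₂.endAlg : Set (Module.End ℚ W))) : Module.End ℚ W) w = w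
        rw [hc_one, map_one, OneMemClass.coe_one, Module.End.one_apply])
      map_mul' := fun g g' => Subtype.ext (LinearEquiv.ext fun w => by
        change ((e (c (g * g')) : Subalgebra.centralizer ℚ (H₂.endAlg : Set (Module.End ℚ W))) : Module.End ℚ W) w =
          ((e (c g) : Subalgebra.centralizer ℚ (H₂.endAlg : Set (Module.End ℚ W))) : Module.End ℚ W)
            (((e (c g') : Subalgebra.centralizer ℚ (H₂.endAlg : Set (Module.End ℚ W))) : Module.End ℚ W) w)
        rw [hc_mul, map_mul, MulMemClass.coe_mul, Module.End.mul_apply]) }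
  have hE₀ : ∀ g : Q₁.lefschetzGroup, (((E₀ g : Q₂.lefschetzGroup) : W ≃ₗ[ℚ] W) : Module.End ℚ W) =
      ((e (c g) : Subalgebra.centralizer ℚ (H₂.endAlg : Set (Module.End ℚ W))) : Module.End ℚ W) := fun g =>
    LinearMap.ext fun _ => rfl
  refine ⟨MulEquiv.ofBijective E₀ ⟨fun g g' h => ?_, fun g₂ => ?_⟩, hE₀⟩
  · -- injective: `e γ_g = e γ_{g'}` forces `γ_g = γ_{g'}`
    have h1 : e (c g) = e (c g') := Subtype.ext (by rw [← hE₀, ← hE₀, h])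
    have h2 : c g = c g' := e.injective h1
    exact Subtype.ext (LinearEquiv.toLinearMap_injective (congrArg Subtype.val h2))
  · -- surjective: `γ₁ = e⁻¹ ↑g₂` satisfies `γ₁†γ₁ = e⁻¹((↑g₂)† ↑g₂) = 1`
    obtain ⟨hg₂C, hg₂⟩ := (Q₂.mem_lefschetzGroup_iff_adjoint_mul_self_eq_one _).1 g₂.2
    let γ₂ : Subalgebra.centralizer ℚ (H₂.endAlg : Set (Module.End ℚ W)) := ⟨_, hg₂C⟩
    obtain ⟨γ₁, hγ₁⟩ : ∃ γ₁ : Subalgebra.centralizer ℚ (H₁.endAlg : Set (Module.End ℚ V)), γ₁ = e.symm γ₂ := ⟨_, rfl⟩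
    have heγ₁ : e γ₁ = γ₂ := by rw [hγ₁, AlgEquiv.apply_symm_apply]
    have hadj₁ : (⟨Q₁.adjoint γ₁, Q₁.adjoint_mem_centralizer_endAlg γ₁.2⟩ :
        Subalgebra.centralizer ℚ (H₁.endAlg : Set (Module.End ℚ V))) * γ₁ = 1 := by
      apply e.injective
      rw [map_mul, map_one]
      apply Subtype.ext
      rw [MulMemClass.coe_mul, OneMemClass.coe_one, he γ₁, heγ₁]
      exact hg₂
    have hadj₁' : Q₁.adjoint (γ₁ : Module.End ℚ V) * (γ₁ : Module.End ℚ V) = 1 := by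
      have h := congrArg (Subtype.val : Subalgebra.centralizer ℚ (H₁.endAlg : Set (Module.End ℚ V)) → Module.End ℚ V) hadj₁
      rwa [MulMemClass.coe_mul, OneMemClass.coe_one] at h
    have hinj₁ : Function.Injective (γ₁ : Module.End ℚ V) := fun v w hvw => by
      have h := congrArg (Q₁.adjoint (γ₁ : Module.End ℚ V)) hvw
      rwa [← Module.End.mul_apply, ← Module.End.mul_apply, hadj₁', Module.End.one_apply, Module.End.one_apply] at h
    have hmem₁ : LinearEquiv.ofInjectiveEndo _ hinj₁ ∈ Q₁.lefschetzGroup :=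
      (Q₁.mem_lefschetzGroup_iff_adjoint_mul_self_eq_one _).2 ⟨γ₁.2, hadj₁'⟩
    refine ⟨⟨LinearEquiv.ofInjectiveEndo _ hinj₁, hmem₁⟩, Subtype.ext (LinearEquiv.ext fun w => ?_)⟩
    have hcγ : c ⟨LinearEquiv.ofInjectiveEndo _ hinj₁, hmem₁⟩ = γ₁ := Subtype.ext (LinearMap.ext fun _ => rfl)
    change ((e (c ⟨LinearEquiv.ofInjectiveEndo _ hinj₁, hmem₁⟩) : Subalgebra.centralizer ℚ (H₂.endAlg : Set (Module.End ℚ W))) :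
      Module.End ℚ W) w = (g₂ : W ≃ₗ[ℚ] W) w
    rw [hcγ, heγ₁]
    rfl

end Functorial

/-! ## §2 The diagonal action `S(H₀)(ℚ) ≃* S(⊕ᵢ Tᵢ)(ℚ)` with its formula -/

section Diagonal

variable {V' : Type u} [AddCommGroup V'] [Module ℚ V'] [Module.Finite ℚ V'] {H' : HodgeStructure V' n}
  {W₀ : Type u} [AddCommGroup W₀] [Module ℚ W₀] [Module.Finite ℚ W₀] {H₀ : HodgeStructure W₀ n}
  {ι : Type} [Fintype ι] [DecidableEq ι] (T : ι → SubHodgeStructure H')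
  (hT : DirectSum.IsInternal fun i => (T i).toSubmodule)
  (r : ∀ i, Hom H₀ (T i).toHodgeStructure) (hr : ∀ i, Function.Bijective (r i).toLinearMap)
  (ψ₀ : Polarization H₀) (ψ' : Polarization H')

include hT hr

omit [Module.Finite ℚ V'] [Module.Finite ℚ W₀] in
/-- **«independent of the choice»: two maps `S(H₀)(ℚ) → S(H')(ℚ)` acting DIAGONALLY along the isomorphisms `rᵢ : H₀ ⥲ Tᵢ` —
`(E g₀)(rᵢ x) = rᵢ (g₀ x)` — COINCIDE.** [cite: Milne1999LefschetzClasses, §1 p. 644 L20–L21 and Prop. 1.5] -/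
theorem Polarization.lefschetzGroup_map_eq_of_forall_apply_hom_eq (E E' : ψ₀.lefschetzGroup → ψ'.lefschetzGroup)
    (hE : ∀ (g₀ : ψ₀.lefschetzGroup) (i : ι) (x : W₀),
      ((E g₀ : ψ'.lefschetzGroup) : V' ≃ₗ[ℚ] V') (((r i).toLinearMap x : (T i).toSubmodule) : V') =
        (((r i).toLinearMap ((g₀ : W₀ ≃ₗ[ℚ] W₀) x) : (T i).toSubmodule) : V'))
    (hE' : ∀ (g₀ : ψ₀.lefschetzGroup) (i : ι) (x : W₀),
      ((E' g₀ : ψ'.lefschetzGroup) : V' ≃ₗ[ℚ] V') (((r i).toLinearMap x : (T i).toSubmodule) : V') =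
        (((r i).toLinearMap ((g₀ : W₀ ≃ₗ[ℚ] W₀) x) : (T i).toSubmodule) : V')) :
    E = E' := by
  refine funext fun g₀ => Subtype.ext (LinearEquiv.ext fun v => ?_)
  rw [← sum_isInternalProj_apply hT Finset.univ (fun j hj => absurd (Finset.mem_univ j) hj) v, map_sum, map_sum]
  refine Finset.sum_congr rfl fun i _ => ?_
  obtain ⟨x, hx⟩ := (hr i).2 ⟨isInternalProj hT i v, isInternalProj_apply_mem hT i v⟩
  have hx' : isInternalProj hT i v = (((r i).toLinearMap x : (T i).toSubmodule) : V') := by rw [hx]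
  rw [hx', hE, hE']

/-- **THE DIAGONAL ACTION `S(H₀, ψ₀)(ℚ) ≃* S(H', ψ')(ℚ)` WITH ITS FORMULA**: for an internal direct sum `V' = ⊕ᵢ Tᵢ` (`ι ≠ ∅`) of
sub-Hodge structures with Hodge isomorphisms `rᵢ : H₀ ⥲ Tᵢ` and ANY polarizations `ψ₀` of `H₀`, `ψ'` of `H'`, there is an isomorphism
of groups `E` with `(E g₀)(rᵢ x) = rᵢ (g₀ x)` («`S(Aᵢ^{rᵢ}) ≅ S(Aᵢ)`»: §1 applied to g53-#3's diagonal `(C(H₀), †₀) ≃ₐ (C(H'), †')`).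
[cite: Milne1999LefschetzClasses, §1 p. 643 L12–L13, p. 644 L20–L21 and Prop. 1.5] -/
theorem Polarization.exists_lefschetzGroup_mulEquiv_apply_hom_eq [Nonempty ι] :
    ∃ E : ψ₀.lefschetzGroup ≃* ψ'.lefschetzGroup, ∀ (g₀ : ψ₀.lefschetzGroup) (i : ι) (x : W₀),
      ((E g₀ : ψ'.lefschetzGroup) : V' ≃ₗ[ℚ] V') (((r i).toLinearMap x : (T i).toSubmodule) : V') =
        (((r i).toLinearMap ((g₀ : W₀ ≃ₗ[ℚ] W₀) x) : (T i).toSubmodule) : V') := by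
  obtain ⟨e, he, hadj⟩ := exists_centralizer_endAlg_algEquiv_apply_hom_eq T hT r hr
  obtain ⟨E, hE⟩ := ψ₀.exists_lefschetzGroup_mulEquiv_coe_eq_of_algEquiv_adjoint ψ' e (hadj ψ₀ ψ')
  refine ⟨E, fun g₀ i x => ?_⟩
  rw [← LinearEquiv.coe_coe, hE, he]
  rfl

end Diagonal

/-! ## §3 The canonical block: RESTRICTION TO `U` is an isomorphism `S(S, ψ|_S)(ℚ) ≃* S(U, ψ|_U)(ℚ)` -/

section CanonicalBlock

variable {V : Type u} [AddCommGroup V] [Module ℚ V] [Module.Finite ℚ V] {H : HodgeStructure V n} (ψ : Polarization H)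
  {S U : SubHodgeStructure H} (hUS : U.toSubmodule ≤ S.toSubmodule)

include hUS

omit [Module.Finite ℚ V] in
/-- **Two maps `S(S)(ℚ) → S(U)(ℚ)` lying over the restriction (`(E g) u = g u` in `V`) COINCIDE** («up to a unique isomorphism»).
[cite: Milne1999LefschetzClasses, §1 p. 644 L20–L21] -/
theorem Polarization.lefschetzGroup_restrict_map_eq_of_forall_coe_apply_eq
    (E E' : (ψ.restrict S).lefschetzGroup → (ψ.restrict U).lefschetzGroup)
    (hE : ∀ (g : (ψ.restrict S).lefschetzGroup) (u : U.toSubmodule),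
      (((E g : (ψ.restrict U).lefschetzGroup) : U.toSubmodule ≃ₗ[ℚ] U.toSubmodule) u : V) =
        (((g : S.toSubmodule ≃ₗ[ℚ] S.toSubmodule) ⟨u, hUS u.2⟩ : S.toSubmodule) : V))
    (hE' : ∀ (g : (ψ.restrict S).lefschetzGroup) (u : U.toSubmodule),
      (((E' g : (ψ.restrict U).lefschetzGroup) : U.toSubmodule ≃ₗ[ℚ] U.toSubmodule) u : V) =
        (((g : S.toSubmodule ≃ₗ[ℚ] S.toSubmodule) ⟨u, hUS u.2⟩ : S.toSubmodule) : V)) :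
    E = E' :=
  funext fun g => Subtype.ext (LinearEquiv.ext fun u => Subtype.ext ((hE g u).trans (hE' g u).symm))

variable (hS : (∀ a ∈ H.endAlg, ∀ v ∈ S.toSubmodule, a v ∈ S.toSubmodule) ∧ S.toSubmodule ≠ ⊥ ∧
    ∀ S' : SubHodgeStructure H, (∀ a ∈ H.endAlg, ∀ v ∈ S'.toSubmodule, a v ∈ S'.toSubmodule) →
      S'.toSubmodule ≤ S.toSubmodule → S'.toSubmodule = ⊥ ∨ S'.toSubmodule = S.toSubmodule)
  (hU : U.toHodgeStructure.IsIrreducible)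

include hS hU

/-- **THE CANONICAL BLOCK `S(S, ψ|_S)(ℚ) ≃* S(U, ψ|_U)(ℚ)` BY RESTRICTION**: for a polarized `H`, a minimal non-zero `E_φ`-stable
sub-Hodge structure `S` and an irreducible `U ⊆ S`, every `g ∈ S(S, ψ|_S)(ℚ)` preserves `U` and `g ↦ g|_U` is an isomorphism of groups
`E`, `(E g) u = g u` (§1 applied to g53-#3's restriction isomorphism `(C(S), †_{ψ|S}) ≃ₐ (C(U), †_{ψ|U})`; «`S(Aᵢ^{rᵢ}) ≅ S(Aᵢ)`» read on
the canonical block `S ≅ U^{⊕m}` of the Hodge structure itself). [cite: Milne1999LefschetzClasses, §1 p. 644 L20–L21 and Prop. 1.5]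
[cite: Lange2023AbelianVarietiesComplex, §7.2.4 Exercise (4)] -/
theorem Polarization.exists_lefschetzGroup_restrict_mulEquiv_coe_apply_eq_of_minimal_stable :
    ∃ E : (ψ.restrict S).lefschetzGroup ≃* (ψ.restrict U).lefschetzGroup,
      ∀ (g : (ψ.restrict S).lefschetzGroup) (u : U.toSubmodule),
        (((E g : (ψ.restrict U).lefschetzGroup) : U.toSubmodule ≃ₗ[ℚ] U.toSubmodule) u : V) =
          (((g : S.toSubmodule ≃ₗ[ℚ] S.toSubmodule) ⟨u, hUS u.2⟩ : S.toSubmodule) : V) := by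
  obtain ⟨e, he, hadj⟩ := ψ.exists_centralizer_endAlg_algEquiv_coe_apply_eq_adjoint_of_minimal_stable hUS hS hU
  obtain ⟨E, hE⟩ := (ψ.restrict S).exists_lefschetzGroup_mulEquiv_coe_eq_of_algEquiv_adjoint (ψ.restrict U) e hadj
  refine ⟨E, fun g u => ?_⟩
  rw [← LinearEquiv.coe_coe, hE, he]
  rfl

/-- **Every `δ ∈ S(U, ψ|_U)(ℚ)` is the restriction of a UNIQUE `g ∈ S(S, ψ|_S)(ℚ)`** (bijectivity of restriction on the canonical block,
spelled out). [cite: Milne1999LefschetzClasses, §1 p. 644 L20–L21 and Prop. 1.5] -/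
theorem Polarization.existsUnique_mem_lefschetzGroup_restrict_forall_coe_apply_eq_of_minimal_stable
    (δ : (ψ.restrict U).lefschetzGroup) :
    ∃! g : S.toSubmodule ≃ₗ[ℚ] S.toSubmodule, g ∈ (ψ.restrict S).lefschetzGroup ∧
      ∀ u : U.toSubmodule, ((g ⟨u, hUS u.2⟩ : S.toSubmodule) : V) =
        (((δ : U.toSubmodule ≃ₗ[ℚ] U.toSubmodule) u : U.toSubmodule) : V) := by
  obtain ⟨E, hE⟩ := ψ.exists_lefschetzGroup_restrict_mulEquiv_coe_apply_eq_of_minimal_stable hUS hS hU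
  refine ⟨(E.symm δ : (ψ.restrict S).lefschetzGroup), ⟨(E.symm δ).2, fun u => ?_⟩, fun g' hg' => ?_⟩
  · rw [← hE (E.symm δ) u, MulEquiv.apply_symm_apply]
  · obtain ⟨hg'S, hg'⟩ := hg'
    have h : E ⟨g', hg'S⟩ = δ :=
      Subtype.ext (LinearEquiv.ext fun u => Subtype.ext ((hE ⟨g', hg'S⟩ u).trans (hg' u)))
    have h' : (⟨g', hg'S⟩ : (ψ.restrict S).lefschetzGroup) = E.symm δ := by
      rw [← h, MulEquiv.symm_apply_apply]
    exact congrArg Subtype.val h'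

end CanonicalBlock

end HodgeStructure

end Literature.AlgebraicGeometry.Motives
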